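import Summits.AtomisticToContinuum.FouriersLaw.Theorems.BondHeatUncertaintyLinearResponseFTURK3Sandwich
import Mathlib.MeasureTheory.Measure.HasOuterApproxClosed

/-!
# The anti-damped Girsanov formula (stub K3 of line `lebesgue-flip-duality`)

Closes stub `stub_antiDampedGirsanov` (K3) of crux ★ `BondHeatUncertainty.LinearResponseFTUR`
(stmt-AtomisticToContinuum-9122): for every measurable `F ≥ 0` on the observable space,

  `e^{2γt} E[F(Θ̃ obs(revPath from Θy))] = E[e^{Q_L/T_L + Q_R/T_R} F(obs(fwdPath from y))]`.

From the two inequalities of `…K3Sandwich.lean` for bounded continuous `G ≥ 0`: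
(I) says `β.withDensity(e^{W-2γt}) ≤ α` tested on `C_b⁺` (`β` = law of `obs X`, `α` = law of
`obs Z`, `Z = Θ∘revPath(Θy)` the anti-damped path, whose raw observable is `Θ̃` of that of the reversed
path, `obs_theta_revPath`), (II) tested on the truncations `G · min(e^{W-2γt}, n)` and `n → ∞` gives the
reverse inequality; the weighted measure is finite by (I) with `G = 1`, so the two measures agree
(`ext_of_forall_lintegral_eq_of_IsFiniteMeasure`) and the identity follows for every measurable `F`.
The degenerate time `t = 0` is checked directly. No Girsanov theorem, no Novikov condition: the change
of measure is done exactly at the level of the finitely many Gaussian increments of the splitting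
schemes (`…DiscreteIdentity.lean`) and passed to the limit pathwise (`…K3Limits.lean`).
-/

noncomputable section

namespace Summit.AtomisticToContinuum.FouriersLaw.Theorems.LinearResponseFTUR

open MeasureTheory Filter Set Function Finset intervalIntegral Topology Metric BoundedContinuousFunction
open scoped NNReal ENNReal
open Literature.MathematicalPhysics.KineticTheory
open Literature.MathematicalPhysics.KineticTheory.HeatConduction
open Literature.Probability.Process
open Literature.Analysis.ODE
open Summit.AtomisticToContinuum.FouriersLaw.Theorems.BondHeatUncertainty
open Summit.AtomisticToContinuum.FouriersLaw.Theorems.SubdiffusiveBondHeat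

variable {N : ℕ}

/-! ### The formula -/

/-- **The anti-damped Girsanov formula at positive times** in measure form: the law of the raw
observable of the anti-damped path equals the law of that of the forward path weighted by
`e^{W - 2γt}`. -/
theorem map_obs_anti_eq_withDensity {ω₂ lam β γ : ℝ} (hω : 0 < ω₂) (hl : 0 < lam) (hβ : 0 < β) (hγ : 0 < γ)
    (hN : 2 ≤ N) (i0 iN ib : Fin N) (hi0 : i0.val = 0) (hiN : iN.val = N - 1) {T_L T_R : ℝ} (hTL : 0 < T_L)
    (hTR : 0 < T_R) {t : ℝ} (ht : 0 < t) (y : PhaseSpace N) :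
    wienerPair.map (fun w => rawObs (pinnedChain ω₂ lam β γ) N i0 iN ib t y (thetaRevPath ω₂ lam β γ N T_L T_R y w)) =
      (wienerPair.map (fun w => rawObs (pinnedChain ω₂ lam β γ) N i0 iN ib t y
        (fwdPath (pinnedChain ω₂ lam β γ) N T_L T_R y w))).withDensity
        (fun p => ENNReal.ofReal (Real.exp (heatFunctional T_L T_R i0 iN p - 2 * γ * t))) := by
  set P := pinnedChain ω₂ lam β γ with hP
  set obsX : WienerPair → Obs N := fun w => rawObs P N i0 iN ib t y (fwdPath P N T_L T_R y w) with hobsX'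
  set obsZ : WienerPair → Obs N := fun w => rawObs P N i0 iN ib t y (thetaRevPath ω₂ lam β γ N T_L T_R y w) with hobsZ'
  set a : Obs N → ℝ := fun p => heatFunctional T_L T_R i0 iN p - 2 * γ * t with ha
  have hac : Continuous a := (continuous_heatFunctional T_L T_R i0 iN).sub continuous_const
  set ρ : Obs N → ℝ≥0∞ := fun p => ENNReal.ofReal (Real.exp (a p)) with hρ
  have hρm : Measurable ρ := ENNReal.measurable_ofReal.comp (Real.measurable_exp.comp hac.measurable)
  have hobsX : Measurable obsX :=
    (EquilibriumBondHeatVariance.measurable_rawObs_fwdPath hω hl.le hβ.le hγ.le N T_L T_R i0 iN ib t).comp (measurable_const.prodMk measurable_id)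
  have hobsZ : Measurable obsZ := measurable_rawObs_thetaRevPath hω hl.le hβ.le hγ.le N T_L T_R i0 iN ib t y
  set βm : Measure (Obs N) := wienerPair.map obsX with hβm
  set αm : Measure (Obs N) := wienerPair.map obsZ with hαm
  -- integrals against the two measures
  have hint_w : ∀ {H : Obs N → ℝ≥0∞}, Measurable H →
      ∫⁻ p, H p ∂(βm.withDensity ρ) = ∫⁻ w, H (obsX w) * ρ (obsX w) ∂wienerPair := by
    intro H hH
    rw [lintegral_withDensity_eq_lintegral_mul _ hρm hH, hβm, lintegral_map (hρm.mul hH) hobsX]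
    simp only [Pi.mul_apply, mul_comm]
  have hint_a : ∀ {H : Obs N → ℝ≥0∞}, Measurable H → ∫⁻ p, H p ∂αm = ∫⁻ w, H (obsZ w) ∂wienerPair := by
    intro H hH
    rw [hαm, lintegral_map hH hobsZ]
  have hGm : ∀ G : Obs N →ᵇ ℝ≥0, Measurable fun p => (G p : ℝ≥0∞) := fun G => G.continuous.measurable.coe_nnreal_ennreal
  -- (I): `∫ G d(β ρ) ≤ ∫ G dα`
  have hI : ∀ G : Obs N →ᵇ ℝ≥0, ∫⁻ p, G p ∂(βm.withDensity ρ) ≤ ∫⁻ p, G p ∂αm := by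
    intro G
    rw [hint_w (hGm G), hint_a (hGm G)]
    exact lintegral_obs_fwd_weighted_le hω hl hβ hγ hN i0 iN ib hi0 hiN hTL hTR ht y G
  -- (II): `∫ G dα ≤ ∫ G d(β ρ)` through the truncations
  have hII : ∀ G : Obs N →ᵇ ℝ≥0, ∫⁻ p, G p ∂αm ≤ ∫⁻ p, G p ∂(βm.withDensity ρ) := by
    intro G
    rw [hint_w (hGm G), hint_a (hGm G)]
    have hn : ∀ n : ℕ, ∫⁻ w, (truncWeight G a hac n (obsZ w) : ℝ≥0∞) * ENNReal.ofReal (Real.exp (-a (obsZ w))) ∂wienerPair ≤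
        ∫⁻ w, (G (obsX w) : ℝ≥0∞) * ρ (obsX w) ∂wienerPair := by
      intro n
      have h2 := lintegral_obs_anti_weighted_le hω hl hβ hγ hN i0 iN ib hi0 hiN hTL hTR ht y (truncWeight G a hac n)
      have hneg : ∀ w, -a (obsZ w) = -heatFunctional T_L T_R i0 iN (obsZ w) + 2 * γ * t := fun w => by
        simp only [ha]; ring
      calc ∫⁻ w, (truncWeight G a hac n (obsZ w) : ℝ≥0∞) * ENNReal.ofReal (Real.exp (-a (obsZ w))) ∂wienerPair
          = ∫⁻ w, (truncWeight G a hac n (obsZ w) : ℝ≥0∞) *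
              ENNReal.ofReal (Real.exp (-heatFunctional T_L T_R i0 iN (obsZ w) + 2 * γ * t)) ∂wienerPair :=
            lintegral_congr fun w => by rw [hneg]
        _ ≤ ∫⁻ w, (truncWeight G a hac n (obsX w) : ℝ≥0∞) ∂wienerPair := h2
        _ ≤ ∫⁻ w, (G (obsX w) : ℝ≥0∞) * ρ (obsX w) ∂wienerPair :=
            lintegral_mono fun w => truncWeight_le G a hac n (obsX w)
    have hmeas : ∀ n : ℕ, Measurable fun w => (truncWeight G a hac n (obsZ w) : ℝ≥0∞) * ENNReal.ofReal (Real.exp (-a (obsZ w))) :=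
      fun n => ((hGm _).comp hobsZ).mul (ENNReal.measurable_ofReal.comp (Real.measurable_exp.comp
        (hac.measurable.comp hobsZ).neg))
    calc ∫⁻ w, (G (obsZ w) : ℝ≥0∞) ∂wienerPair
        = ∫⁻ w, ⨆ n : ℕ, (truncWeight G a hac n (obsZ w) : ℝ≥0∞) * ENNReal.ofReal (Real.exp (-a (obsZ w))) ∂wienerPair :=
          lintegral_congr fun w => (iSup_truncWeight_mul G a hac (obsZ w)).symm
      _ = ⨆ n : ℕ, ∫⁻ w, (truncWeight G a hac n (obsZ w) : ℝ≥0∞) * ENNReal.ofReal (Real.exp (-a (obsZ w))) ∂wienerPair :=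
          lintegral_iSup hmeas fun n n' h w => monotone_truncWeight_mul G a hac (obsZ w) h
      _ ≤ ∫⁻ w, (G (obsX w) : ℝ≥0∞) * ρ (obsX w) ∂wienerPair := iSup_le hn
  -- finiteness and equality
  haveI : IsFiniteMeasure (βm.withDensity ρ) := by
    refine ⟨?_⟩
    have h := hI (bcfOne (Obs N))
    haveI := Literature.Probability.RandomPlanarGeometry.isProbabilityMeasure_preWienerMeasure'
    haveI : IsProbabilityMeasure wienerPair := by unfold wienerPair; infer_instance
    have h1 : ∫⁻ p, (bcfOne (Obs N) p : ℝ≥0∞) ∂(βm.withDensity ρ) = (βm.withDensity ρ) univ := by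
      rw [← lintegral_one]; rfl
    have h2 : ∫⁻ p, (bcfOne (Obs N) p : ℝ≥0∞) ∂αm = 1 := by
      rw [hint_a (hGm _)]
      show ∫⁻ w, ((1 : ℝ≥0) : ℝ≥0∞) ∂wienerPair = 1
      rw [ENNReal.coe_one, lintegral_one, measure_univ]
    rw [← h1]
    exact (h.trans_eq h2).trans_lt ENNReal.one_lt_top
  have heq : βm.withDensity ρ = αm :=
    ext_of_forall_lintegral_eq_of_IsFiniteMeasure fun G => le_antisymm (hI G) (hII G)
  exact heq.symm

/-- **The anti-damped Girsanov formula** (stub K3 of line `lebesgue-flip-duality`, registered signature). -/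
theorem stub_antiDampedGirsanov :
  ∀ ω₂ lam β γ : ℝ, 0 < ω₂ → 0 < lam → 0 < β → 0 < γ →
  ∀ (N : ℕ) (i0 iN ib : Fin N), 2 ≤ N → i0.val = 0 → iN.val = N - 1 →
  ∀ (T_L T_R : ℝ), 0 < T_L → 0 < T_R → ∀ t : ℝ, 0 ≤ t →
  ∀ (y : PhaseSpace N) (F : Obs N → ℝ≥0∞), Measurable F →
    ENNReal.ofReal (Real.exp (2 * γ * t)) *
        ∫⁻ w, F (swapObs N (flipObs N (rawObs (pinnedChain ω₂ lam β γ) N i0 iN ib t (y.1, -y.2)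
          (revPath (pinnedChain ω₂ lam β γ) N T_L T_R (y.1, -y.2) w)))) ∂wienerPair =
      ∫⁻ w, ENNReal.ofReal (Real.exp
          (leftHeat i0 (rawObs (pinnedChain ω₂ lam β γ) N i0 iN ib t y
              (fwdPath (pinnedChain ω₂ lam β γ) N T_L T_R y w)) / T_L +
            rightHeat iN (rawObs (pinnedChain ω₂ lam β γ) N i0 iN ib t y
              (fwdPath (pinnedChain ω₂ lam β γ) N T_L T_R y w)) / T_R)) *
        F (rawObs (pinnedChain ω₂ lam β γ) N i0 iN ib t y
          (fwdPath (pinnedChain ω₂ lam β γ) N T_L T_R y w)) ∂wienerPair := by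
  intro ω₂ lam β γ hω hl hβ hγ N i0 iN ib hN hi0 hiN T_L T_R hTL hTR t ht y F hF
  -- the anti-damped path's observable
  simp only [obs_theta_revPath]
  rcases eq_or_lt_of_le ht with rfl | htpos
  · -- `t = 0`: both paths sit at `y`, all integrals vanish
    have hP := pinnedChain_isConfining hω hl.le hβ.le hγ.le
    have hX0 : ∀ w, fwdPath (pinnedChain ω₂ lam β γ) N T_L T_R y w 0 = y := fun w => by
      rw [fwdPath_eq_drivenFlow]
      show drivenFlow _ y _ 0 = y
      rw [(hP.confinedDrift N).toConfinedDrift.flow_of_nonpos y (continuous_chainPairNoise ω₂ lam β γ N T_L T_R w) le_rfl,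
        chainPairNoise_zero, add_zero]
    have hZ0 : ∀ w, thetaRevPath ω₂ lam β γ N T_L T_R y w 0 = y := fun w => by
      simp only [thetaRevPath, revPath_eq_drivenFlow]
      rw [(hP.reversedDrift N).toConfinedDrift.flow_of_nonpos _ (continuous_chainPairNoise ω₂ lam β γ N T_L T_R w) le_rfl,
        chainPairNoise_zero, add_zero]
      simp
    simp only [rawObs, workIntegral, bondHeat, intervalIntegral.integral_same, hX0, hZ0, leftHeat, rightHeat]
    simp
  · have hmap := map_obs_anti_eq_withDensity hω hl hβ hγ hN i0 iN ib hi0 hiN hTL hTR htpos y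
    have hobsX : Measurable fun w => rawObs (pinnedChain ω₂ lam β γ) N i0 iN ib t y
        (fwdPath (pinnedChain ω₂ lam β γ) N T_L T_R y w) :=
      (EquilibriumBondHeatVariance.measurable_rawObs_fwdPath hω hl.le hβ.le hγ.le N T_L T_R i0 iN ib t).comp (measurable_const.prodMk measurable_id)
    have hobsZ : Measurable fun w => rawObs (pinnedChain ω₂ lam β γ) N i0 iN ib t y (thetaRevPath ω₂ lam β γ N T_L T_R y w) :=
      measurable_rawObs_thetaRevPath hω hl.le hβ.le hγ.le N T_L T_R i0 iN ib t y
    have hρm : Measurable fun p : Obs N => ENNReal.ofReal (Real.exp (heatFunctional T_L T_R i0 iN p - 2 * γ * t)) :=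
      ENNReal.measurable_ofReal.comp (Real.measurable_exp.comp
        (((continuous_heatFunctional T_L T_R i0 iN).sub continuous_const).measurable))
    have h1 : ∫⁻ w, F (rawObs (pinnedChain ω₂ lam β γ) N i0 iN ib t y (thetaRevPath ω₂ lam β γ N T_L T_R y w)) ∂wienerPair =
        ∫⁻ w, F (rawObs (pinnedChain ω₂ lam β γ) N i0 iN ib t y (fwdPath (pinnedChain ω₂ lam β γ) N T_L T_R y w)) *
          ENNReal.ofReal (Real.exp (heatFunctional T_L T_R i0 iN (rawObs (pinnedChain ω₂ lam β γ) N i0 iN ib t y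
            (fwdPath (pinnedChain ω₂ lam β γ) N T_L T_R y w)) - 2 * γ * t)) ∂wienerPair := by
      rw [← lintegral_map hF hobsZ, hmap, lintegral_withDensity_eq_lintegral_mul _ hρm hF,
        lintegral_map (hρm.mul hF) hobsX]
      simp only [Pi.mul_apply, mul_comm]
    have hm : Measurable fun w => F (rawObs (pinnedChain ω₂ lam β γ) N i0 iN ib t y
        (fwdPath (pinnedChain ω₂ lam β γ) N T_L T_R y w)) *
          ENNReal.ofReal (Real.exp (heatFunctional T_L T_R i0 iN (rawObs (pinnedChain ω₂ lam β γ) N i0 iN ib t y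
            (fwdPath (pinnedChain ω₂ lam β γ) N T_L T_R y w)) - 2 * γ * t)) := (hF.comp hobsX).mul (hρm.comp hobsX)
    rw [h1, ← lintegral_const_mul _ hm]
    refine lintegral_congr fun w => ?_
    rw [mul_comm (F _), ← mul_assoc, ← ENNReal.ofReal_mul (Real.exp_pos _).le, ← Real.exp_add]
    congr 2
    simp only [heatFunctional]
    ring

end Summit.AtomisticToContinuum.FouriersLaw.Theorems.LinearResponseFTUR

end
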